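/-
Copyright (c) 2026. All rights reserved.
Released under Apache 2.0 license as described in the file LICENSE.
-/
import Literature.NumberTheory.ComplexMultiplication.DegenerateCMTypesAbelianSurvivorTernaryClosure
import Literature.NumberTheory.ComplexMultiplication.DegenerateCMTypesAbelianRankTwoCosets
import HarnessLib

/-!
# Extremal CM types on a finite abelian group: the survivors form a coset of a subgroup of the character group;
# and the parity lemma for real characters

SETTING (tree `CMTypeRankCharacters`, `DegenerateCMTypesAbelianStabilizerCharacters`,
`DegenerateCMTypesAbelianSurvivorClosure`, `DegenerateCMTypesAbelianSurvivorTernaryClosure`).  `G` a finite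
commutative group (the Galois group of an abelian CM field), `ρ ∈ G`, `T ⊆ G` a CM type (`IsCMTypeWith ρ T`),
`Ŝ(χ) = Σ_{t ∈ T} χ(t)` for `χ : AddChar (Additive G) ℂ` (additive notation), `S(T) = {χ : χ(ρ) = −1, Ŝ(χ) ≠ 0}` the
SURVIVORS (`rank(T) = 1 + #S(T)`, T. Kubota [Kubota1965] §4 Lemma 2 = B. B. Gordon [Gordon1999HodgeAVSurvey] Prop.
9.4.1), `Stab(T) = {g : Tg = T}`.  The type is EXTREMAL when `2·|Stab(T)|·(rank(T) − 1) = |G|` — on the field side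
`Bᵐ(A) ⊗ ℂ = Dᵐ(A) ⊗ ℂ` for all `m` on every abelian variety of the type, otherwise an exceptional Hodge class on `A`
(tree `Pohlmann1968.forall_hodgeClassSpan_eq_iff_forall_add_add`); the tree knows extremal ⟺ every odd character of
`⟨S⟩` survives (g40-#1) ⟺ `S` is closed under triple products (g40-#5).  THIS FILE gives the STRUCTURE of the
survivor set of an extremal type, and a parity lemma producing survivors:

> **Theorem** (`two_mul_card_stabilizer_mul_eq_iff_exists_addSubgroup`).  `T` is extremal **iff its survivors form
> a coset `S(T) = χ₀ + E` of a subgroup `E ≤ Ĝ`** (necessarily `E =` the even part of `⟨S⟩`, `χ₀` any survivor: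
> `two_mul_card_stabilizer_mul_eq_iff_forall_mem_iff_sub_mem`); then `#S(T) = rank(T) − 1 = |E|`.  On the field
> side: `B = D` on `A` iff Kubota's survivors are a coset in the character group of `Gal(K/ℚ)`.
> **Theorem** (`sum_ne_zero_of_add_self_eq_zero_of_odd_card`, `mem_survivors_of_add_self_eq_zero`).  A REAL
> character (`2χ = 0`) does not vanish on a set of ODD size; hence for `|T| = |G|/2` odd every real odd character is
> a survivor, and `rank(T) ≥ 1 + #{χ real odd}` (`card_filter_real_odd_le_typeRank_sub_one`).

The coset theorem generalises the tree's rank-`2` picture (`T` itself a coset of an index-`2` subgroup,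
`DegenerateCMTypesAbelianRankTwoCosets`; there `S = {ψ}`, `E = 0`) and the majority types (`S = χ₁ + {0, χ₁+χ₂,
χ₁+χ₃, χ₂+χ₃}`… in exponent `2`: `S = {χ₁, χ₂, χ₃, χ₁+χ₂+χ₃} = χ₁ + ⟨χ₁+χ₂, χ₁+χ₃⟩`).

* §1 `two_le_typeRank` (every CM type has a survivor — tree `AbelianRankTwo.exists_odd_sum_char_ne_zero` — so `rank ≥ 2`).
* §2 PARITY: `apply_eq_one_or_eq_neg_one_of_add_self_eq_zero`, **`sum_ne_zero_of_add_self_eq_zero_of_odd_card`**,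
  **`mem_survivors_of_add_self_eq_zero`** (`|T|` odd: real odd characters survive),
  `card_filter_real_odd_le_typeRank_sub_one`.
* §3 COSETS: `sub_apply_rho_eq_one` (two odd characters differ by an even one), **`forall_mem_iff_sub_mem_of_extremal`**
  (extremal ⟹ `S = χ₀ + (even part of ⟨S⟩)` for every survivor `χ₀`), **`forall_add_add_of_forall_mem_iff_sub_mem`**
  (a coset of ANY subgroup is ternary-closed, using conjugation closure `2χ₀ ∈ E`),
  **`two_mul_card_stabilizer_mul_eq_iff_forall_mem_iff_sub_mem`**, **`two_mul_card_stabilizer_mul_eq_iff_exists_addSubgroup`**.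

HONEST SCOPE.  Elementary group theory on top of g40-#1/g40-#5; the sources print Kubota's formula and the primitive
criterion; the coset form and the parity lemma are this file's packaging, not numbered statements of the sources.
THEOREMS ONLY: no definition, no named fact, no instance, no `sorry`.

## References

* [Kubota1965] T. Kubota, *On the field extension by complex multiplication*, Trans. AMS 118 (1965), §2, §4 Lemma 2.
* [Gordon1999HodgeAVSurvey] B. B. Gordon, *A survey of the Hodge conjecture for abelian varieties*, Thm. 6.4, §9.2,
  Prop. 9.4.1.
* [Dodson1984] B. Dodson, *The structure of Galois groups of CM-fields*, Trans. AMS 283 (1984), §3.1.1 (proof).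
* [White1993SporadicCycles] S. P. White, *Sporadic cycles on CM abelian varieties*, Compositio Math. 88 (1993), §4 Thm. 3.

## Provenance

Lane `lit-hodgefound` (Track 2, Layer A3), seat `lit-hodgefound-p10` generation 40, row g40-#7; neighbours cited by
name, nothing restated: `DegenerateCMTypesAbelianSurvivorTernaryClosure` (g40-#5: `neg_mem_survivors`,
`neg_apply_eq_conj`, `two_mul_card_stabilizer_mul_eq_iff_forall_add_add`), `DegenerateCMTypesAbelianSurvivorClosure`
(g40-#1: `two_mul_card_stabilizer_mul_eq_iff_forall_mem_closure`), `DegenerateCMTypesAbelianRankTwoCosets`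
(`AbelianRankTwo.exists_odd_sum_char_ne_zero`), `CMTypeRankCharacters` (`IsCMTypeWith.typeRank_eq_one_add_ncard_oddCharacters`),
`CMTypeElementaryTwoGroupOddWeights` (`character_apply_eq_one_or_of_mul_self`).
-/

open scoped BigOperators Classical ComplexConjugate

namespace Literature.NumberTheory.ComplexMultiplication

namespace CyclicCMType

namespace AbelianStabilizer

variable {G : Type*} [CommGroup G] [Fintype G] [DecidableEq G] {ρ : G} {T : Finset G}

/-! ## §0 Helpers -/

section Helpers

omit [Fintype G] [DecidableEq G] in
/-- `ρ² = 1`. [folklore] -/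
private theorem rho_mul_rho_co (h : IsCMTypeWith ρ (T : Set G)) : ρ * ρ = 1 := by
  have := h.invol (1 : G)
  simpa [smul_eq_mul] using this

omit [Fintype G] [DecidableEq G] in
/-- `χ(ρ) = ±1`. [folklore] -/
private theorem char_rho_co (h : IsCMTypeWith ρ (T : Set G)) (χ : AddChar (Additive G) ℂ) :
    χ (Additive.ofMul ρ) = 1 ∨ χ (Additive.ofMul ρ) = -1 :=
  character_apply_eq_one_or_of_mul_self χ (rho_mul_rho_co h)

omit [DecidableEq G] in
/-- Kubota's count with the survivors as a finset: `rank = 1 + #surv`. [cite: Kubota1965, §4 Lemma 2] -/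
private theorem typeRank_eq_one_add_card_co (h : IsCMTypeWith ρ (T : Set G)) :
    typeRank G (T : Set G) = 1 + ((Finset.univ.filter fun χ : AddChar (Additive G) ℂ =>
      χ (Additive.ofMul ρ) = -1).filter fun χ => ∑ s ∈ T, χ (Additive.ofMul s) ≠ 0).card := by
  rw [h.typeRank_eq_one_add_ncard_oddCharacters, ← Set.ncard_coe_finset]
  congr 2
  ext χ
  simp only [Set.mem_setOf_eq, Finset.coe_filter, Finset.mem_filter, Finset.mem_univ, true_and]

end Helpers

/-! ## §1 Every CM type has a survivor: `rank ≥ 2` -/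

section Survivor

/-- **`rank(T) ≥ 2`** for every CM type on a finite commutative group: some odd character survives (tree
`AbelianRankTwo.exists_odd_sum_char_ne_zero`, Parseval `Σ_{odd} |Ŝ|² = |T|²`). [cite: Kubota1965, §4 Lemma 2] -/
theorem two_le_typeRank (h : IsCMTypeWith ρ (T : Set G)) : 2 ≤ typeRank G (T : Set G) := by
  obtain ⟨χ, hχ, hS⟩ := AbelianRankTwo.exists_odd_sum_char_ne_zero h
  rw [typeRank_eq_one_add_card_co h]
  have : 1 ≤ ((Finset.univ.filter fun χ : AddChar (Additive G) ℂ =>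
      χ (Additive.ofMul ρ) = -1).filter fun χ => ∑ s ∈ T, χ (Additive.ofMul s) ≠ 0).card :=
    Finset.card_pos.2 ⟨χ, by simp only [Finset.mem_filter, Finset.mem_univ, true_and]; exact ⟨hχ, hS⟩⟩
  omega

end Survivor

/-! ## §2 The parity lemma: a real character does not vanish on a set of odd size -/

section Parity

omit [Fintype G] [DecidableEq G] in
/-- A real character (`χ + χ = 0`) is `±1`-valued. [folklore] -/
private theorem apply_eq_or_of_add_self_eq_zero {χ : AddChar (Additive G) ℂ} (hχ : χ + χ = 0) (g : G) :
    χ (Additive.ofMul g) = 1 ∨ χ (Additive.ofMul g) = -1 := by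
  have h2 : χ (Additive.ofMul g) * χ (Additive.ofMul g) = 1 := by
    rw [← AddChar.add_apply, hχ, AddChar.zero_apply]
  have h3 : (χ (Additive.ofMul g) - 1) * (χ (Additive.ofMul g) + 1) = 0 := by ring_nf; rw [sq, h2]; ring
  rcases mul_eq_zero.1 h3 with h4 | h4
  · exact Or.inl (sub_eq_zero.1 h4)
  · exact Or.inr (eq_neg_of_add_eq_zero_left h4)

omit [Fintype G] [DecidableEq G] in
/-- **A real character is `±1`-valued**: `χ + χ = 0 ⟹ χ(g) ∈ {1, −1}`. [cite: Kubota1965, §4 Lemma 2 (proof)] -/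
theorem apply_eq_one_or_eq_neg_one_of_add_self_eq_zero {χ : AddChar (Additive G) ℂ} (hχ : χ + χ = 0) (g : G) :
    χ (Additive.ofMul g) = 1 ∨ χ (Additive.ofMul g) = -1 :=
  apply_eq_or_of_add_self_eq_zero hχ g

omit [Fintype G] [DecidableEq G] in
/-- **THE PARITY LEMMA: a real character does not vanish on a finset of odd size** (`Σ_{s ∈ D} χ(s) = a − b` with
`a + b = |D|` odd). [cite: Kubota1965, §4 Lemma 2 (proof)] [cite: Dodson1984, §3.1.1 Theorem (proof)] -/
theorem sum_ne_zero_of_add_self_eq_zero_of_odd_card {χ : AddChar (Additive G) ℂ} (hχ : χ + χ = 0) {D : Finset G}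
    (hD : Odd D.card) : ∑ s ∈ D, χ (Additive.ofMul s) ≠ 0 := by
  have hsplit : ∑ s ∈ D, χ (Additive.ofMul s) =
      ((D.filter fun s => χ (Additive.ofMul s) = 1).card : ℂ) -
        ((D.filter fun s => ¬ χ (Additive.ofMul s) = 1).card : ℂ) := by
    rw [← Finset.sum_filter_add_sum_filter_not D (fun s => χ (Additive.ofMul s) = 1)]
    rw [Finset.sum_congr rfl (fun s hs => (Finset.mem_filter.1 hs).2), Finset.sum_const, nsmul_eq_mul, mul_one]
    rw [Finset.sum_congr rfl (g := fun _ => (-1 : ℂ)) (fun s hs => ?_), Finset.sum_const, nsmul_eq_mul, mul_neg,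
      mul_one, sub_eq_add_neg]
    exact (apply_eq_or_of_add_self_eq_zero hχ s).resolve_left (Finset.mem_filter.1 hs).2
  have hcard := D.card_filter_add_card_filter_not (fun s => χ (Additive.ofMul s) = 1)
  intro h0
  rw [hsplit, sub_eq_zero] at h0
  have hab : (D.filter fun s => χ (Additive.ofMul s) = 1).card =
      (D.filter fun s => ¬ χ (Additive.ofMul s) = 1).card := by exact_mod_cast h0
  rw [hab] at hcard
  rcases hD with ⟨k, hk⟩
  omega

omit [Fintype G] [DecidableEq G] in
/-- **`|T|` ODD ⟹ EVERY REAL ODD CHARACTER IS A SURVIVOR** (e.g. `|G| ≡ 2 (mod 4)`: the sign character of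
`G ≅ C₂ × G_odd` survives for every CM type). [cite: Kubota1965, §4 Lemma 2] [cite: Dodson1984, §3.1.1 Theorem (proof)] -/
theorem mem_survivors_of_add_self_eq_zero (hT : Odd T.card) {χ : AddChar (Additive G) ℂ} (hχ : χ + χ = 0)
    (hodd : χ (Additive.ofMul ρ) = -1) :
    χ ∈ {χ : AddChar (Additive G) ℂ | χ (Additive.ofMul ρ) = -1 ∧ ∑ s ∈ T, χ (Additive.ofMul s) ≠ 0} :=
  ⟨hodd, sum_ne_zero_of_add_self_eq_zero_of_odd_card hχ hT⟩

omit [DecidableEq G] in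
/-- **`|T|` odd ⟹ `rank(T) − 1 ≥ #{χ : 2χ = 0, χ(ρ) = −1}`** (all real odd characters survive).
[cite: Kubota1965, §4 Lemma 2] -/
theorem card_filter_real_odd_le_typeRank_sub_one (h : IsCMTypeWith ρ (T : Set G)) (hT : Odd T.card) :
    (Finset.univ.filter fun χ : AddChar (Additive G) ℂ => χ + χ = 0 ∧ χ (Additive.ofMul ρ) = -1).card ≤
      typeRank G (T : Set G) - 1 := by
  rw [typeRank_eq_one_add_card_co h, Nat.add_sub_cancel_left]
  refine Finset.card_le_card fun χ hχ => ?_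
  simp only [Finset.mem_filter, Finset.mem_univ, true_and] at hχ ⊢
  exact ⟨hχ.2, sum_ne_zero_of_add_self_eq_zero_of_odd_card hχ.1 hT⟩

end Parity

/-! ## §3 Extremal types: the survivors form a coset of the even part of `⟨S⟩` -/

section Cosets

omit [DecidableEq G] in
/-- Two odd characters differ by an even one: `(χ − χ₀)(ρ) = 1`. [cite: Kubota1965, §4 Lemma 2] -/
theorem sub_apply_rho_eq_one {χ χ₀ : AddChar (Additive G) ℂ} (hχ : χ (Additive.ofMul ρ) = -1)
    (hχ₀ : χ₀ (Additive.ofMul ρ) = -1) : (χ - χ₀) (Additive.ofMul ρ) = 1 := by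
  rw [sub_eq_add_neg, AddChar.add_apply, neg_apply_eq_conj, hχ, hχ₀, map_neg, map_one]; norm_num

omit [Fintype G] [DecidableEq G] in
/-- An odd character plus an even one is odd. [cite: Kubota1965, §4 Lemma 2] -/
theorem add_apply_rho_of_eq_one {χ χ₀ : AddChar (Additive G) ℂ} (hχ : χ (Additive.ofMul ρ) = 1)
    (hχ₀ : χ₀ (Additive.ofMul ρ) = -1) : (χ + χ₀) (Additive.ofMul ρ) = -1 := by
  rw [AddChar.add_apply, hχ, hχ₀, one_mul]

/-- **EXTREMAL ⟹ THE SURVIVORS ARE THE COSET `χ₀ + E`, `E` THE EVEN PART OF `⟨S⟩`, FOR EVERY SURVIVOR `χ₀`**: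
if `2·|Stab(T)|·(rank(T) − 1) = |G|` then `χ ∈ S ⟺ χ − χ₀ ∈ ⟨S⟩ ∧ (χ − χ₀)(ρ) = 1`. [cite: Kubota1965, §2 and §4 Lemma 2]
[cite: White1993SporadicCycles, §4 Theorem 3] [cite: Gordon1999HodgeAVSurvey, Thm. 6.4 and Prop. 9.4.1] -/
theorem forall_mem_iff_sub_mem_of_extremal (h : IsCMTypeWith ρ (T : Set G))
    (hext : 2 * (Finset.univ.filter fun g : G => ∀ t : G, t * g ∈ T ↔ t ∈ T).card * (typeRank G (T : Set G) - 1) =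
      Fintype.card G)
    {χ₀ : AddChar (Additive G) ℂ}
    (hχ₀ : χ₀ ∈ {χ : AddChar (Additive G) ℂ | χ (Additive.ofMul ρ) = -1 ∧ ∑ s ∈ T, χ (Additive.ofMul s) ≠ 0})
    (χ : AddChar (Additive G) ℂ) :
    χ ∈ {χ : AddChar (Additive G) ℂ | χ (Additive.ofMul ρ) = -1 ∧ ∑ s ∈ T, χ (Additive.ofMul s) ≠ 0} ↔
      χ - χ₀ ∈ AddSubgroup.closure {χ : AddChar (Additive G) ℂ |
          χ (Additive.ofMul ρ) = -1 ∧ ∑ s ∈ T, χ (Additive.ofMul s) ≠ 0} ∧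
        (χ - χ₀) (Additive.ofMul ρ) = 1 := by
  have hodd := (two_mul_card_stabilizer_mul_eq_iff_forall_mem_closure h).1 hext
  constructor
  · intro hχ
    exact ⟨AddSubgroup.sub_mem _ (AddSubgroup.subset_closure hχ) (AddSubgroup.subset_closure hχ₀),
      sub_apply_rho_eq_one hχ.1 hχ₀.1⟩
  · rintro ⟨hmem, heven⟩
    have hχmem : χ ∈ AddSubgroup.closure {χ : AddChar (Additive G) ℂ |
        χ (Additive.ofMul ρ) = -1 ∧ ∑ s ∈ T, χ (Additive.ofMul s) ≠ 0} := by
      have := AddSubgroup.add_mem _ hmem (AddSubgroup.subset_closure hχ₀)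
      rwa [sub_add_cancel] at this
    have hχodd : χ (Additive.ofMul ρ) = -1 := by
      have := add_apply_rho_of_eq_one heven hχ₀.1
      rwa [sub_add_cancel] at this
    exact ⟨hχodd, hodd χ hχmem hχodd⟩

omit [DecidableEq G] in
/-- **A COSET OF A SUBGROUP IS TERNARY-CLOSED**: if `S = χ₀ + E` for a subgroup `E ≤ Ĝ` and a survivor `χ₀` (i.e.
`χ ∈ S ⟺ χ − χ₀ ∈ E`), then `S` is closed under triple products — `2χ₀ ∈ E` because `χ̄₀ = −χ₀` is a survivor.
[cite: Kubota1965, §4 Lemma 2] [cite: Dodson1984, §3.1.1 Theorem (proof)] -/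
theorem forall_add_add_of_forall_mem_iff_sub_mem (E : AddSubgroup (AddChar (Additive G) ℂ))
    {χ₀ : AddChar (Additive G) ℂ}
    (hχ₀ : χ₀ ∈ {χ : AddChar (Additive G) ℂ | χ (Additive.ofMul ρ) = -1 ∧ ∑ s ∈ T, χ (Additive.ofMul s) ≠ 0})
    (hE : ∀ χ : AddChar (Additive G) ℂ,
      χ ∈ {χ : AddChar (Additive G) ℂ | χ (Additive.ofMul ρ) = -1 ∧ ∑ s ∈ T, χ (Additive.ofMul s) ≠ 0} ↔
        χ - χ₀ ∈ E) :
    ∀ χ₁ ∈ {χ : AddChar (Additive G) ℂ | χ (Additive.ofMul ρ) = -1 ∧ ∑ s ∈ T, χ (Additive.ofMul s) ≠ 0},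
      ∀ χ₂ ∈ {χ : AddChar (Additive G) ℂ | χ (Additive.ofMul ρ) = -1 ∧ ∑ s ∈ T, χ (Additive.ofMul s) ≠ 0},
      ∀ χ₃ ∈ {χ : AddChar (Additive G) ℂ | χ (Additive.ofMul ρ) = -1 ∧ ∑ s ∈ T, χ (Additive.ofMul s) ≠ 0},
        χ₁ + χ₂ + χ₃ ∈ {χ : AddChar (Additive G) ℂ | χ (Additive.ofMul ρ) = -1 ∧ ∑ s ∈ T, χ (Additive.ofMul s) ≠ 0} := by
  intro χ₁ h₁ χ₂ h₂ χ₃ h₃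
  have h2χ₀ : χ₀ + χ₀ ∈ E := by
    have hneg := (hE (-χ₀)).1 (neg_mem_survivors hχ₀)
    have : -χ₀ - χ₀ = -(χ₀ + χ₀) := by abel
    rw [this] at hneg
    exact (AddSubgroup.neg_mem_iff E).1 hneg |> fun h => by simpa using h
  rw [hE]
  have e₁ := (hE χ₁).1 h₁
  have e₂ := (hE χ₂).1 h₂
  have e₃ := (hE χ₃).1 h₃
  have : χ₁ + χ₂ + χ₃ - χ₀ = (χ₁ - χ₀) + (χ₂ - χ₀) + (χ₃ - χ₀) + (χ₀ + χ₀) := by abel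
  rw [this]
  exact AddSubgroup.add_mem _ (AddSubgroup.add_mem _ (AddSubgroup.add_mem _ e₁ e₂) e₃) h2χ₀

/-- **EXTREMAL ⟺ THE SURVIVORS ARE THE COSET `χ₀ + (⟨S⟩ ∩ ker ρ)` OF SOME (EVERY) SURVIVOR `χ₀`**:
`2·|Stab(T)|·(rank(T) − 1) = |G| ⟺ ∃ χ₀ ∈ S, ∀ χ, (χ ∈ S ⟺ χ − χ₀ ∈ ⟨S⟩ ∧ (χ − χ₀)(ρ) = 1)`.
[cite: Kubota1965, §2 and §4 Lemma 2] [cite: White1993SporadicCycles, §4 Theorem 3] [cite: Gordon1999HodgeAVSurvey, Thm. 6.4 and Prop. 9.4.1] -/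
theorem two_mul_card_stabilizer_mul_eq_iff_forall_mem_iff_sub_mem (h : IsCMTypeWith ρ (T : Set G)) :
    2 * (Finset.univ.filter fun g : G => ∀ t : G, t * g ∈ T ↔ t ∈ T).card * (typeRank G (T : Set G) - 1) =
      Fintype.card G ↔
      ∃ χ₀ ∈ {χ : AddChar (Additive G) ℂ | χ (Additive.ofMul ρ) = -1 ∧ ∑ s ∈ T, χ (Additive.ofMul s) ≠ 0},
        ∀ χ : AddChar (Additive G) ℂ,
          χ ∈ {χ : AddChar (Additive G) ℂ | χ (Additive.ofMul ρ) = -1 ∧ ∑ s ∈ T, χ (Additive.ofMul s) ≠ 0} ↔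
            χ - χ₀ ∈ AddSubgroup.closure {χ : AddChar (Additive G) ℂ |
                χ (Additive.ofMul ρ) = -1 ∧ ∑ s ∈ T, χ (Additive.ofMul s) ≠ 0} ∧
              (χ - χ₀) (Additive.ofMul ρ) = 1 := by
  constructor
  · intro hext
    obtain ⟨χ₀, hχ₀, hS₀⟩ := AbelianRankTwo.exists_odd_sum_char_ne_zero h
    exact ⟨χ₀, ⟨hχ₀, hS₀⟩, forall_mem_iff_sub_mem_of_extremal h hext ⟨hχ₀, hS₀⟩⟩
  · rintro ⟨χ₀, hχ₀, hE⟩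
    -- `E = ⟨S⟩ ∩ {even}` is a subgroup; a coset of a subgroup is ternary-closed
    let E : AddSubgroup (AddChar (Additive G) ℂ) :=
      { carrier := {χ | χ ∈ AddSubgroup.closure {χ : AddChar (Additive G) ℂ |
            χ (Additive.ofMul ρ) = -1 ∧ ∑ s ∈ T, χ (Additive.ofMul s) ≠ 0} ∧ χ (Additive.ofMul ρ) = 1}
        add_mem' := fun {a b} ha hb =>
          ⟨AddSubgroup.add_mem _ ha.1 hb.1, by rw [AddChar.add_apply, ha.2, hb.2, mul_one]⟩
        zero_mem' := ⟨AddSubgroup.zero_mem _, AddChar.zero_apply _⟩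
        neg_mem' := fun {a} ha => ⟨AddSubgroup.neg_mem _ ha.1, by rw [neg_apply_eq_conj, ha.2, map_one]⟩ }
    have hE' : ∀ χ : AddChar (Additive G) ℂ,
        χ ∈ {χ : AddChar (Additive G) ℂ | χ (Additive.ofMul ρ) = -1 ∧ ∑ s ∈ T, χ (Additive.ofMul s) ≠ 0} ↔
          χ - χ₀ ∈ E := hE
    rw [two_mul_card_stabilizer_mul_eq_iff_forall_add_add h]
    intro χ₁ χ₂ χ₃ h₁ hS₁ h₂ hS₂ h₃ hS₃
    exact (forall_add_add_of_forall_mem_iff_sub_mem E hχ₀ hE' χ₁ ⟨h₁, hS₁⟩ χ₂ ⟨h₂, hS₂⟩ χ₃ ⟨h₃, hS₃⟩).2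

/-- **EXTREMAL ⟺ THE SURVIVORS FORM A COSET OF A SUBGROUP OF THE CHARACTER GROUP**:
`2·|Stab(T)|·(rank(T) − 1) = |G|` iff there are a subgroup `E ≤ Ĝ` and a survivor `χ₀` with `S(T) = χ₀ + E`.  On the
field side (abelian CM field, any type, any abelian variety of the type): `Bᵐ(A) ⊗ ℂ = Dᵐ(A) ⊗ ℂ` for all `m` iff
Kubota's survivors are a coset in the character group of `Gal(K/ℚ)`. [cite: Kubota1965, §2 and §4 Lemma 2]
[cite: White1993SporadicCycles, §4 Theorem 3] [cite: Gordon1999HodgeAVSurvey, Thm. 6.4 and Prop. 9.4.1] -/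
theorem two_mul_card_stabilizer_mul_eq_iff_exists_addSubgroup (h : IsCMTypeWith ρ (T : Set G)) :
    2 * (Finset.univ.filter fun g : G => ∀ t : G, t * g ∈ T ↔ t ∈ T).card * (typeRank G (T : Set G) - 1) =
      Fintype.card G ↔
      ∃ E : AddSubgroup (AddChar (Additive G) ℂ),
        ∃ χ₀ ∈ {χ : AddChar (Additive G) ℂ | χ (Additive.ofMul ρ) = -1 ∧ ∑ s ∈ T, χ (Additive.ofMul s) ≠ 0},
          ∀ χ : AddChar (Additive G) ℂ,
            χ ∈ {χ : AddChar (Additive G) ℂ | χ (Additive.ofMul ρ) = -1 ∧ ∑ s ∈ T, χ (Additive.ofMul s) ≠ 0} ↔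
              χ - χ₀ ∈ E := by
  constructor
  · intro hext
    obtain ⟨χ₀, hχ₀, hS₀⟩ := AbelianRankTwo.exists_odd_sum_char_ne_zero h
    let E : AddSubgroup (AddChar (Additive G) ℂ) :=
      { carrier := {χ | χ ∈ AddSubgroup.closure {χ : AddChar (Additive G) ℂ |
            χ (Additive.ofMul ρ) = -1 ∧ ∑ s ∈ T, χ (Additive.ofMul s) ≠ 0} ∧ χ (Additive.ofMul ρ) = 1}
        add_mem' := fun {a b} ha hb =>
          ⟨AddSubgroup.add_mem _ ha.1 hb.1, by rw [AddChar.add_apply, ha.2, hb.2, mul_one]⟩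
        zero_mem' := ⟨AddSubgroup.zero_mem _, AddChar.zero_apply _⟩
        neg_mem' := fun {a} ha => ⟨AddSubgroup.neg_mem _ ha.1, by rw [neg_apply_eq_conj, ha.2, map_one]⟩ }
    exact ⟨E, χ₀, ⟨hχ₀, hS₀⟩, forall_mem_iff_sub_mem_of_extremal h hext ⟨hχ₀, hS₀⟩⟩
  · rintro ⟨E, χ₀, hχ₀, hE⟩
    rw [two_mul_card_stabilizer_mul_eq_iff_forall_add_add h]
    intro χ₁ χ₂ χ₃ h₁ hS₁ h₂ hS₂ h₃ hS₃
    exact (forall_add_add_of_forall_mem_iff_sub_mem E hχ₀ hE χ₁ ⟨h₁, hS₁⟩ χ₂ ⟨h₂, hS₂⟩ χ₃ ⟨h₃, hS₃⟩).2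

omit [DecidableEq G] in
/-- **In the coset case `#S(T) = |E|`**: the survivors are in bijection with the subgroup (`χ ↦ χ − χ₀`), so
`rank(T) − 1 = |E|`. [cite: Kubota1965, §4 Lemma 2] [cite: Gordon1999HodgeAVSurvey, Prop. 9.4.1] -/
theorem typeRank_sub_one_eq_natCard_of_forall_mem_iff_sub_mem (h : IsCMTypeWith ρ (T : Set G))
    (E : AddSubgroup (AddChar (Additive G) ℂ)) {χ₀ : AddChar (Additive G) ℂ}
    (hE : ∀ χ : AddChar (Additive G) ℂ,
      χ ∈ {χ : AddChar (Additive G) ℂ | χ (Additive.ofMul ρ) = -1 ∧ ∑ s ∈ T, χ (Additive.ofMul s) ≠ 0} ↔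
        χ - χ₀ ∈ E) :
    typeRank G (T : Set G) - 1 = Nat.card E := by
  rw [typeRank_eq_one_add_card_co h, Nat.add_sub_cancel_left, ← Nat.card_eq_finsetCard]
  refine Nat.card_congr ⟨fun χ => ⟨χ.1 - χ₀, (hE χ.1).1 (by
      have := χ.2
      simp only [Finset.mem_filter, Finset.mem_univ, true_and] at this
      exact this)⟩,
    fun e => ⟨e.1 + χ₀, by
      simp only [Finset.mem_filter, Finset.mem_univ, true_and]
      exact (hE (e.1 + χ₀)).2 (by rw [add_sub_cancel_right]; exact e.2)⟩, fun χ => ?_, fun e => ?_⟩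
  · apply Subtype.ext
    show χ.1 - χ₀ + χ₀ = χ.1
    rw [sub_add_cancel]
  · apply Subtype.ext
    show e.1 + χ₀ - χ₀ = e.1
    rw [add_sub_cancel_right]

end Cosets

end AbelianStabilizer

end CyclicCMType

end Literature.NumberTheory.ComplexMultiplication
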